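import Literature.MathematicalPhysics.QuantumLattice.GrassmannNearIdentityStep
import HarnessLib

/-!
# The near-identity step for a LOCAL interaction: only the entries the interaction can contract enter the Wick bound

Topic `MathematicalPhysics/QuantumLattice`; refinement of `GrassmannGaussConvKernelBound` (Wick bound of `Δ_C W`, `e^{Δ_C}W − W` with the SUP
entry `s ≥ ‖C(A,B)‖`) and `GrassmannNearIdentityStep` (`effAction C W − W` in every degree).  When the kernels of `W` are supported on tuples of
legs that are pairwise related by a reflexive-free relation `T` (e.g. "same time slice" for the time-local Hubbard vertex and counterterm on the
grid), every Wick self-contraction reads an entry `C(A,B)` with `T A B`; so the sup entry `s` may be replaced by a bound `t ≥ ‖C(A,B)‖` for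
`T`-related pairs only.  This matters for the MATSUBARA SHELL covariance between two cutoffs, whose equal-time entries are `O(β/M)` while its
sup entry one grid step apart is `O(1)` (Gibbs; `HubbardMatsubaraShellTadpole`).

* `IsKernelLocal T W` (the support property), `IsKernelLocal.add/smul/map_laplacian/map_laplacian_pow`;
* `sum_norm_kernel_grassmannLaplacian_le_of_local`, `…_pow_le_of_local`, **`sum_norm_kernel_gaussConv_sub_le_of_local`**;
* **`sum_norm_kernel_effAction_sub_self_le_of_local`** — the near-identity step with the `T`-restricted entry bound.

Everything is proved; `IsKernelLocal` is the only definition; no named fact.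

## Sources
G. Benfatto, A. Giuliani, V. Mastropietro, Ann. Henri Poincaré 7 (2006) 809–898, (2.13)–(2.14), (2.86)–(2.90) [`BenfattoGiulianiMastropietro2006`];
M. Salmhofer, *Renormalization* (1999), §4.3 (4.86)–(4.95) [`Salmhofer1999`].  The `[cite: …]` tags LOCATE the constructs; the statements are
routine variants of the cited bounds.
-/

noncomputable section

namespace Literature.MathematicalPhysics.QuantumLattice

open GrassmannAlgebra Finset Literature.Probability.LatticeModels
open scoped Nat

universe u

section Local

variable {𝕜 : Type*} [RCLike 𝕜] {Γ : Type u} [Fintype Γ] [DecidableEq Γ]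

/-- **`T`-locality of an element of the Grassmann algebra**: every nonzero kernel is supported on tuples of pairwise `T`-related legs
(Salmhofer's coefficient functions (4.95) of a local interaction). [cite: Salmhofer1999, §4.3 (4.95)] -/
def IsKernelLocal (T : Γ → Γ → Prop) (W : GrassmannAlgebra 𝕜 Γ) : Prop :=
  ∀ (n : ℕ) (Z : Fin n → Γ), kernel 𝕜 W n Z ≠ 0 → ∀ i j : Fin n, T (Z i) (Z j)

variable {T : Γ → Γ → Prop}

omit [Fintype Γ] [DecidableEq Γ] in
/-- `0` is local. [cite: Salmhofer1999, §4.3 (4.95)] -/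
theorem isKernelLocal_zero : IsKernelLocal T (0 : GrassmannAlgebra 𝕜 Γ) := fun n Z h =>
  absurd (by rw [kernel_def, map_zero, map_zero, mul_zero]) h

omit [Fintype Γ] [DecidableEq Γ] in
/-- Sums of local elements are local. [cite: Salmhofer1999, §4.3 (4.95)] -/
theorem IsKernelLocal.add {W W' : GrassmannAlgebra 𝕜 Γ} (hW : IsKernelLocal T W) (hW' : IsKernelLocal T W') : IsKernelLocal T (W + W') := by
  intro n Z h i j
  rw [kernel_add] at h
  by_cases h1 : kernel 𝕜 W n Z = 0
  · rw [h1, zero_add] at h; exact hW' n Z h i j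
  · exact hW n Z h1 i j

omit [Fintype Γ] [DecidableEq Γ] in
/-- Scalar multiples of local elements are local. [cite: Salmhofer1999, §4.3 (4.95)] -/
theorem IsKernelLocal.smul {W : GrassmannAlgebra 𝕜 Γ} (hW : IsKernelLocal T W) (c : 𝕜) : IsKernelLocal T (c • W) := by
  intro n Z h i j
  rw [kernel_smul] at h
  exact hW n Z (right_ne_zero_of_mul h) i j

omit [Fintype Γ] [DecidableEq Γ] in
/-- Finite sums of local elements are local. [cite: Salmhofer1999, §4.3 (4.95)] -/
theorem isKernelLocal_sum {ι : Type*} (s : Finset ι) {W : ι → GrassmannAlgebra 𝕜 Γ} (hW : ∀ i ∈ s, IsKernelLocal T (W i)) :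
    IsKernelLocal T (∑ i ∈ s, W i) := by
  classical
  induction s using Finset.induction_on with
  | empty => rw [sum_empty]; exact isKernelLocal_zero
  | insert a s ha ih =>
    rw [sum_insert ha]
    exact (hW a (mem_insert_self a s)).add (ih fun i hi => hW i (mem_insert_of_mem hi))

omit [DecidableEq Γ] in
/-- **A Laplacian preserves locality** (the kernels of `Δ_C W` are contractions of those of `W`). [cite: Salmhofer1999, §4.3.2 (4.86)] -/
theorem IsKernelLocal.map_laplacian {W : GrassmannAlgebra 𝕜 Γ} (hW : IsKernelLocal T W) (C : Matrix Γ Γ 𝕜) :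
    IsKernelLocal T (grassmannLaplacian 𝕜 C W) := by
  intro m X h i j
  rw [kernel_grassmannLaplacian] at h
  obtain ⟨A, -, hA⟩ := exists_ne_zero_of_sum_ne_zero (right_ne_zero_of_mul h)
  obtain ⟨B, -, hB⟩ := exists_ne_zero_of_sum_ne_zero hA
  have hk := right_ne_zero_of_mul hB
  have := hW (m + 2) _ hk (Fin.castSucc (Fin.castSucc i)) (Fin.castSucc (Fin.castSucc j))
  simpa only [Fin.snoc_castSucc] using this

omit [DecidableEq Γ] in
/-- Powers of a Laplacian preserve locality. [cite: Salmhofer1999, §4.3.2 (4.86)] -/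
theorem IsKernelLocal.map_laplacian_pow {W : GrassmannAlgebra 𝕜 Γ} (hW : IsKernelLocal T W) (C : Matrix Γ Γ 𝕜) :
    ∀ j : ℕ, IsKernelLocal T ((grassmannLaplacian 𝕜 C ^ j) W)
  | 0 => by simpa using hW
  | j + 1 => by
    rw [pow_succ', Module.End.mul_apply]
    exact (IsKernelLocal.map_laplacian_pow hW C j).map_laplacian C

/-- **The `T`-restricted Wick bound for one Laplacian**: if `‖C(A,B)‖ ≤ t` whenever `T A B`, and `W` is `T`-local, then
`Σ_{X : X_i = w} ‖kernel (Δ_C W) m X‖ ≤ ((m+1)(m+2)/2)·t·Σ_{Z : Z_i = w} ‖kernel W (m+2) Z‖`. [cite: BenfattoGiulianiMastropietro2006, (2.86)-(2.90)] -/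
theorem sum_norm_kernel_grassmannLaplacian_le_of_local (C : Matrix Γ Γ 𝕜) {t : ℝ} (ht : ∀ A B, T A B → ‖C A B‖ ≤ t)
    {W : GrassmannAlgebra 𝕜 Γ} (hW : IsKernelLocal T W) (m : ℕ) (i : Fin m) (w : Γ) :
    ∑ X ∈ univ.filter (fun X : Fin m → Γ => X i = w), ‖kernel 𝕜 (grassmannLaplacian 𝕜 C W) m X‖ ≤
      (((m + 1) * (m + 2) : ℕ) : ℝ) / 2 * t *
        ∑ Z ∈ univ.filter (fun Z : Fin (m + 1 + 1) → Γ => Z (Fin.castSucc (Fin.castSucc i)) = w), ‖kernel 𝕜 W (m + 2) Z‖ := by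
  have hcoef : ‖(((((m + 1) * (m + 2) : ℕ) : ℚ) / 2) • (1 : 𝕜))‖ = (((m + 1) * (m + 2) : ℕ) : ℝ) / 2 := by
    rw [Rat.smul_one_eq_cast, ← RCLike.ofReal_ratCast, RCLike.norm_ofReal]
    push_cast
    exact abs_of_nonneg (by positivity)
  -- the contraction estimate, using locality when the kernel is nonzero
  have hAB : ∀ (X : Fin m → Γ) (A B : Γ),
      ‖C A B * kernel 𝕜 W (m + 2) (Fin.snoc (Fin.snoc X B : Fin (m + 1) → Γ) A)‖ ≤
        t * ‖kernel 𝕜 W (m + 2) (Fin.snoc (Fin.snoc X B : Fin (m + 1) → Γ) A)‖ := by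
    intro X A B
    rw [norm_mul]
    by_cases hk : kernel 𝕜 W (m + 2) (Fin.snoc (Fin.snoc X B : Fin (m + 1) → Γ) A) = 0
    · rw [hk, norm_zero, mul_zero, mul_zero]
    · refine mul_le_mul_of_nonneg_right (ht A B ?_) (norm_nonneg _)
      have := hW (m + 2) _ hk (Fin.last (m + 1)) (Fin.castSucc (Fin.last m))
      simpa only [Fin.snoc_last, Fin.snoc_castSucc] using this
  have hpt : ∀ X : Fin m → Γ, ‖kernel 𝕜 (grassmannLaplacian 𝕜 C W) m X‖ ≤
      (((m + 1) * (m + 2) : ℕ) : ℝ) / 2 * t * ∑ A, ∑ B, ‖kernel 𝕜 W (m + 2) (Fin.snoc (Fin.snoc X B : Fin (m + 1) → Γ) A)‖ := by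
    intro X
    rw [kernel_grassmannLaplacian, norm_mul, hcoef, mul_assoc]
    refine mul_le_mul_of_nonneg_left ?_ (by positivity)
    rw [mul_sum]
    refine (norm_sum_le _ _).trans (sum_le_sum fun A _ => ?_)
    rw [mul_sum]
    exact (norm_sum_le _ _).trans (sum_le_sum fun B _ => hAB X A B)
  refine (sum_le_sum fun X _ => hpt X).trans (le_of_eq ?_)
  rw [← mul_sum, sum_filter_sum_sum_snoc_snoc_eq (fun Z => ‖kernel 𝕜 W (m + 2) Z‖) i w]

/-- **The `T`-restricted Wick bound for `j` Laplacians.** [cite: BenfattoGiulianiMastropietro2006, (2.86)-(2.90)] -/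
theorem sum_norm_kernel_grassmannLaplacian_pow_le_of_local (C : Matrix Γ Γ 𝕜) {t : ℝ} (ht0 : 0 ≤ t) (ht : ∀ A B, T A B → ‖C A B‖ ≤ t)
    {W : GrassmannAlgebra 𝕜 Γ} (hW : IsKernelLocal T W) (N : ℕ → ℝ)
    (hN : ∀ (n : ℕ) (p : Fin n) (w : Γ), ∑ Z ∈ univ.filter (fun Z : Fin n → Γ => Z p = w), ‖kernel 𝕜 W n Z‖ ≤ N n) :
    ∀ (j m : ℕ) (i : Fin m) (w : Γ),
      ∑ X ∈ univ.filter (fun X : Fin m → Γ => X i = w), ‖kernel 𝕜 ((grassmannLaplacian 𝕜 C ^ j) W) m X‖ ≤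
        ((m + 2 * j)! : ℝ) / ((m ! : ℝ) * 2 ^ j) * t ^ j * N (m + 2 * j) := by
  -- generalise over `W` so that the induction can use the locality of `Δ^j W`
  suffices h : ∀ (j : ℕ) (W' : GrassmannAlgebra 𝕜 Γ), IsKernelLocal T W' → ∀ (N' : ℕ → ℝ),
      (∀ (n : ℕ) (p : Fin n) (w : Γ), ∑ Z ∈ univ.filter (fun Z : Fin n → Γ => Z p = w), ‖kernel 𝕜 W' n Z‖ ≤ N' n) →
      ∀ (m : ℕ) (i : Fin m) (w : Γ), ∑ X ∈ univ.filter (fun X : Fin m → Γ => X i = w), ‖kernel 𝕜 ((grassmannLaplacian 𝕜 C ^ j) W') m X‖ ≤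
        ((m + 2 * j)! : ℝ) / ((m ! : ℝ) * 2 ^ j) * t ^ j * N' (m + 2 * j) from fun j m i w => h j W hW N hN m i w
  intro j
  induction j with
  | zero =>
    intro W' _ N' hN' m i w
    have h := hN' m i w
    simp only [pow_zero, Module.End.one_apply, Nat.mul_zero, Nat.add_zero, mul_one]
    rwa [div_self (by positivity), one_mul]
  | succ j ih =>
    intro W' hW' N' hN' m i w
    rw [pow_succ, Module.End.mul_apply]
    -- `Δ^j (Δ W')`: apply the induction hypothesis to `Δ W'`, whose pinned norms come from the one-step bound
    have hloc := hW'.map_laplacian C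
    have hN'' : ∀ (n : ℕ) (p : Fin n) (w : Γ), ∑ Z ∈ univ.filter (fun Z : Fin n → Γ => Z p = w),
        ‖kernel 𝕜 (grassmannLaplacian 𝕜 C W') n Z‖ ≤ (((n + 1) * (n + 2) : ℕ) : ℝ) / 2 * t * N' (n + 2) := by
      intro n p w
      exact (sum_norm_kernel_grassmannLaplacian_le_of_local C ht hW' n p w).trans
        (mul_le_mul_of_nonneg_left (hN' _ _ _) (by positivity))
    refine (ih _ hloc _ hN'' m i w).trans (le_of_eq ?_)
    have hmf : ((m + 2 * j + 2)! : ℝ) = (m + 2 * j + 2 : ℝ) * ((m + 2 * j + 1 : ℝ) * ((m + 2 * j)! : ℝ)) := by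
      rw [Nat.factorial_succ, Nat.factorial_succ]; push_cast; ring
    rw [show m + 2 * (j + 1) = m + 2 * j + 2 by ring, hmf]
    have hm0 : (m ! : ℝ) ≠ 0 := by positivity
    have hf0 : ((m + 2 * j)! : ℝ) ≠ 0 := by positivity
    push_cast
    field_simp
    ring

/-- **The first-order part of the flow for a LOCAL interaction**: with `Δ_C^k = 0` and `‖C(A,B)‖ ≤ t` for `T`-related pairs,
`Σ_{X : X_i = w} ‖kernel (e^{Δ_C}W − W) m X‖ ≤ Σ_{1 ≤ j < k} ((m+2j)!/(m! j! 2^j)) t^j N(m+2j)`. [cite: BenfattoGiulianiMastropietro2006, (2.86)-(2.90)] -/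
theorem sum_norm_kernel_gaussConv_sub_le_of_local (C : Matrix Γ Γ 𝕜) {k : ℕ} (hk : grassmannLaplacian 𝕜 C ^ k = 0) {t : ℝ} (ht0 : 0 ≤ t)
    (ht : ∀ A B, T A B → ‖C A B‖ ≤ t) {W : GrassmannAlgebra 𝕜 Γ} (hW : IsKernelLocal T W) (N : ℕ → ℝ)
    (hN : ∀ (n : ℕ) (p : Fin n) (w : Γ), ∑ Z ∈ univ.filter (fun Z : Fin n → Γ => Z p = w), ‖kernel 𝕜 W n Z‖ ≤ N n)
    (m : ℕ) (i : Fin m) (w : Γ) :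
    ∑ X ∈ univ.filter (fun X : Fin m → Γ => X i = w), ‖kernel 𝕜 (gaussConv 𝕜 C W - W) m X‖ ≤
      ∑ j ∈ Ico 1 k, ((m + 2 * j)! : ℝ) / ((m ! : ℝ) * (j ! : ℝ) * 2 ^ j) * t ^ j * N (m + 2 * j) := by
  have hexp : gaussConv 𝕜 C W - W = ∑ j ∈ Ico 1 k, ((j ! : ℚ)⁻¹) • (grassmannLaplacian 𝕜 C ^ j) W := by
    rcases Nat.eq_zero_or_pos k with rfl | hkpos
    · have h1 : (1 : Module.End 𝕜 (GrassmannAlgebra 𝕜 Γ)) = 0 := by rwa [pow_zero] at hk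
      have hW0 : W = 0 := by simpa using congrArg (fun T : Module.End 𝕜 (GrassmannAlgebra 𝕜 Γ) => T W) h1
      simp [hW0]
    · rw [gaussConv, IsNilpotent.exp_eq_sum hk, LinearMap.coe_sum, Finset.sum_apply, range_eq_Ico,
        sum_eq_sum_Ico_succ_bot hkpos]
      simp only [LinearMap.smul_apply, pow_zero, Nat.factorial_zero, Nat.cast_one, inv_one, one_smul,
        Module.End.one_apply, add_sub_cancel_left]
  rw [hexp]
  calc ∑ X ∈ univ.filter (fun X : Fin m → Γ => X i = w),
        ‖kernel 𝕜 (∑ j ∈ Ico 1 k, ((j ! : ℚ)⁻¹) • (grassmannLaplacian 𝕜 C ^ j) W) m X‖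
      ≤ ∑ X ∈ univ.filter (fun X : Fin m → Γ => X i = w),
          ∑ j ∈ Ico 1 k, (j ! : ℝ)⁻¹ * ‖kernel 𝕜 ((grassmannLaplacian 𝕜 C ^ j) W) m X‖ := by
        refine sum_le_sum fun X _ => ?_
        rw [kernel_sum]
        refine (norm_sum_le _ _).trans (sum_le_sum fun j _ => le_of_eq ?_)
        rw [← Rat.cast_smul_eq_qsmul 𝕜, kernel_smul, norm_mul, Rat.cast_inv, Rat.cast_natCast, norm_inv,
          RCLike.norm_natCast]
    _ = ∑ j ∈ Ico 1 k, (j ! : ℝ)⁻¹ * ∑ X ∈ univ.filter (fun X : Fin m → Γ => X i = w),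
          ‖kernel 𝕜 ((grassmannLaplacian 𝕜 C ^ j) W) m X‖ := by
        rw [sum_comm]
        exact sum_congr rfl fun j _ => by rw [mul_sum]
    _ ≤ ∑ j ∈ Ico 1 k, (j ! : ℝ)⁻¹ * (((m + 2 * j)! : ℝ) / ((m ! : ℝ) * 2 ^ j) * t ^ j * N (m + 2 * j)) :=
        sum_le_sum fun j _ => mul_le_mul_of_nonneg_left
          (sum_norm_kernel_grassmannLaplacian_pow_le_of_local C ht0 ht hW N hN j m i w) (by positivity)
    _ = _ := sum_congr rfl fun j _ => by
        have hj : (j ! : ℝ) ≠ 0 := by positivity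
        have hm : (m ! : ℝ) ≠ 0 := by positivity
        field_simp

/-- **THE NEAR-IDENTITY STEP FOR A LOCAL INTERACTION**: as `GrassmannNearIdentityStep.sum_norm_kernel_effAction_sub_self_le_of_gramBounded`,
with the sup entry `s` replaced by the bound `t` on the `T`-RELATED entries of `C` (`W` `T`-local).
[cite: BenfattoGiulianiMastropietro2006, (2.86)-(2.90)] -/
theorem sum_norm_kernel_effAction_sub_self_le_of_local (C : Matrix Γ Γ 𝕜) {κ : ℝ} (hκ : 0 < κ) (hGB : IsGramBoundedR C κ)
    (W : GrassmannAlgebra 𝕜 Γ) (hW : W ∈ evenPart 𝕜 Γ) (hW0 : constPart 𝕜 W = 0) (hloc : IsKernelLocal T W) (N : ℕ → ℝ) (hN0 : ∀ n, 0 ≤ N n)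
    (hN : ∀ (n : ℕ) (p : Fin n) (w : Γ), ∑ Z ∈ univ.filter (fun Z : Fin n → Γ => Z p = w), ‖kernel 𝕜 W n Z‖ ≤ N n)
    {α : ℝ} (hα : 0 < α) (hrow : ∀ X, ∑ Y, ‖C X Y‖ ≤ α) (hcol : ∀ Y, ∑ X, ‖C X Y‖ ≤ α) {ρ : ℝ} (hρ : 0 < ρ)
    (hθ : Real.exp 1 * α * normV Γ κ ρ (fun m' => N (2 * m')) / κ ^ 2 < 1)
    {t : ℝ} (ht0 : 0 ≤ t) (ht : ∀ A B, T A B → ‖C A B‖ ≤ t) {k : ℕ} (hk : grassmannLaplacian 𝕜 C ^ k = 0) :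
    IsUnit (effPartitionFn 𝕜 C W) ∧ ∀ {m : ℕ}, 0 < m → ∀ (i : Fin m) (w : Γ),
      ∑ X ∈ univ.filter (fun X : Fin m → Γ => X i = w), ‖kernel 𝕜 (effAction 𝕜 C W) m X - kernel 𝕜 W m X‖ ≤
        ∑ j ∈ Ico 1 k, ((m + 2 * j)! : ℝ) / ((m ! : ℝ) * (j ! : ℝ) * 2 ^ j) * t ^ j * N (m + 2 * j) +
          ρ⁻¹ ^ m * (Real.exp 1 * normV Γ κ ρ (fun m' => N (2 * m'))) *
            (Real.exp 1 * α * normV Γ κ ρ (fun m' => N (2 * m')) / κ ^ 2) /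
              (1 - Real.exp 1 * α * normV Γ κ ρ (fun m' => N (2 * m')) / κ ^ 2) := by
  obtain ⟨hunit, hnl⟩ := sum_norm_kernel_effAction_sub_gaussConv_le_of_gramBounded C hκ hGB W hW hW0 (fun m' => N (2 * m'))
    (fun m' => hN0 _) (fun m' j w => hN (2 * m') j w) hα hrow hcol hρ hθ
  refine ⟨hunit, @fun m hm i w => ?_⟩
  have hlin := sum_norm_kernel_gaussConv_sub_le_of_local C hk ht0 ht hloc N hN m i w
  have hksub : ∀ (A B : GrassmannAlgebra 𝕜 Γ) (X : Fin m → Γ), kernel 𝕜 (A - B) m X = kernel 𝕜 A m X - kernel 𝕜 B m X := by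
    intro A B X
    rw [sub_eq_add_neg, kernel_add, ← neg_one_smul 𝕜 B, kernel_smul, neg_one_mul, ← sub_eq_add_neg]
  have hsplit : ∀ X : Fin m → Γ, kernel 𝕜 (effAction 𝕜 C W) m X - kernel 𝕜 W m X =
      kernel 𝕜 (effAction 𝕜 C W - gaussConv 𝕜 C W) m X + kernel 𝕜 (gaussConv 𝕜 C W - W) m X := by
    intro X
    rw [hksub, hksub]
    ring
  calc ∑ X ∈ univ.filter (fun X : Fin m → Γ => X i = w), ‖kernel 𝕜 (effAction 𝕜 C W) m X - kernel 𝕜 W m X‖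
      ≤ ∑ X ∈ univ.filter (fun X : Fin m → Γ => X i = w),
          (‖kernel 𝕜 (effAction 𝕜 C W - gaussConv 𝕜 C W) m X‖ + ‖kernel 𝕜 (gaussConv 𝕜 C W - W) m X‖) :=
        sum_le_sum fun X _ => by rw [hsplit]; exact norm_add_le _ _
    _ = ∑ X ∈ univ.filter (fun X : Fin m → Γ => X i = w), ‖kernel 𝕜 (effAction 𝕜 C W - gaussConv 𝕜 C W) m X‖ +
          ∑ X ∈ univ.filter (fun X : Fin m → Γ => X i = w), ‖kernel 𝕜 (gaussConv 𝕜 C W - W) m X‖ := sum_add_distrib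
    _ ≤ _ := by rw [add_comm]; exact add_le_add hlin (hnl hm i w)

end Local

end Literature.MathematicalPhysics.QuantumLattice
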